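import Summits.BirchSwinnertonDyer.BirchSwinnertonDyer.Theorems.ResidualThetaTransportAtTwoThetaLayerLambdaCongruenceAtTwoDepletion
import Literature.NumberTheory.EllipticCurves.GreenbergVatsal2000.EulerFactorDepletion
import HarnessLib

/-!
# Crux `MazurTateCongruenceAtTwoTop` / `MazurTateCongruenceAtTwoR` (stmt-BirchSwinnertonDyer-25797 = 21416 by name,
# route ThetaPartnerAtTwo, K1 row), line `symbol`: the DEPLETION IDENTITY for the Greenberg–Vatsal symbol tables
# `eulerDepleteTableList` at the layers of the cyclotomic `ℤ₂`-extension (lead prover bsd-wall-tp2-p1 g10;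
# `--supports stmt-BirchSwinnertonDyer-21416`; closes nothing)

HONEST FRAMING. THEOREMS of the tree's definitions only (finite group-ring algebra over `ℚ₂` + the Teichmüller
decomposition `ℓ ≡ ±5^{f_ℓ}`); nothing about any curve or form is asserted; BSD is not proved by any of this.

WHAT. For a `1`-periodic even table `φ : ℚ → ℚ` (e.g. the rational plus symbol `[·]⁺_f` of a cusp form) write
`ϑ_n(φ) = ∑_{s mod 2ⁿ} φ(5^s/2^{n+2}) (1+X)^s ∈ ℚ₂[X]` (the single-count layer sum; the tree's Mazur–Tate element at
`p = 2` is `θ_n(f) = 2·ϑ_n([·]⁺_f)`, `Sprung2017.mazurTateElement_two_eq`). For a LIST `l` of odd places and an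
elliptic curve `W/ℚ` (Euler polynomials `P_v = W.localPolynomialAt v`), the Greenberg–Vatsal / Emerton–Pollack–Weston
DEPLETED TABLE `φ^{l} = eulerDepleteTableList W l φ` (Literature `GreenbergVatsal2000/EulerFactorDepletion`:
`(P_v(ℓ⁻¹[ℓ])φ)(x) = Σ_i c_i ℓ^{-i} φ(ℓ^i x)`, iterated over `l`) satisfies

  `ϑ_n(φ) · ∏_{v ∈ l} P_v ∘ (ℓ_v⁻¹ (1+X)^{e_v}) ≡ ϑ_n(φ^{l})  (mod (1+X)^{2ⁿ} − 1)`,  `e_v = (−f_{ℓ_v}) mod 2ⁿ`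

(`layerSum_mul_prod_dvd_sub_layerSum_eulerDepleteTableList`; `f_ℓ = GreenbergVatsal2000.frobeniusExponent 2 ℓ`, so
`(1+X)^{e_v} = σ_{ℓ_v}⁻¹` in the layer group ring) — the finite-layer form of `θ_n(f_{Σ₀}) = θ_n(f)·∏_ℓ P_ℓ(ℓ⁻¹σ_ℓ⁻¹)`
(Greenberg–Vatsal 2000 §1 display (8)) in the currency of the Literature depletion operator. It is the LIST-ITERATED twin of
`ThetaLayerLambdaCongruenceAtTwo.layerSum_mul_prod_eulerFactor_congr` (route ResidualThetaTransportAtTwo, which expands the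
product over `k : S₀ → {0,1,2}` instead), proved from the same one-place dilation lemma `layerSum_dilate_congr`. Also: the
depleted table of an even / `1`-periodic table is even / `1`-periodic (§1).

USE. Companion file `…MazurTateCongruenceAtTwoROfSymbolLaw`: the crux `MazurTateCongruenceAtTwoR` follows from a
congruence law for the depleted Néron-normalised plus-symbol tables of the theta pair on the `2`-power cusps.

References: [GreenbergVatsal2000] §1 p. 9 (display (8)); [EmertonPollackWeston2006] §3 (3.4)–(3.5);
[MazurTateTeitelbaum1986Invent] §I.8, §I.13.
-/

set_option linter.dupNamespace false
set_option autoImplicit false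

noncomputable section

open scoped Classical

open Polynomial NumberField IsDedekindDomain
  Literature.NumberTheory.EllipticCurves Literature.NumberTheory.EllipticCurves.GreenbergVatsal2000
  Summit.BirchSwinnertonDyer.BirchSwinnertonDyer.Theorems.ThetaLayerLambdaCongruenceAtTwo

namespace Summit.BirchSwinnertonDyer.BirchSwinnertonDyer.Theorems.MazurTateCongruenceAtTwoR

/-! ## §1. The depleted table of an even, `1`-periodic table is even and `1`-periodic -/

section Tables

variable (W : WeierstrassCurve ℚ)

/-- The one-place depletion `P_v(ℓ⁻¹[ℓ])φ` of an even table is even. [cite: EmertonPollackWeston2006, §3 (3.4)–(3.5)] -/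
theorem eulerDepleteTable_neg (v : HeightOneSpectrum (𝓞 ℚ)) {φ : ℚ → ℚ} (hφ : ∀ x, φ (-x) = φ x) (x : ℚ) :
    eulerDepleteTable W v φ (-x) = eulerDepleteTable W v φ x := by
  simp only [eulerDepleteTable]
  refine Finset.sum_congr rfl fun i _ ↦ ?_
  rw [mul_neg, hφ]

/-- The depleted table `eulerDepleteTableList W l φ` of an even table is even. [cite: EmertonPollackWeston2006, §3 (3.4)–(3.5)] -/
theorem eulerDepleteTableList_neg (l : List (HeightOneSpectrum (𝓞 ℚ))) {φ : ℚ → ℚ} (hφ : ∀ x, φ (-x) = φ x) :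
    ∀ x : ℚ, eulerDepleteTableList W l φ (-x) = eulerDepleteTableList W l φ x := by
  induction l with
  | nil => exact hφ
  | cons v l ih =>
    intro x
    show eulerDepleteTable W v (eulerDepleteTableList W l φ) (-x) = eulerDepleteTable W v (eulerDepleteTableList W l φ) x
    exact eulerDepleteTable_neg W v ih x

/-- The one-place depletion of a `1`-periodic table is `1`-periodic (`ℓ^i · z ∈ ℤ`). [cite: EmertonPollackWeston2006, §3 (3.4)–(3.5)] -/
theorem eulerDepleteTable_add_intCast (v : HeightOneSpectrum (𝓞 ℚ)) {φ : ℚ → ℚ}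
    (hφ : ∀ (x : ℚ) (z : ℤ), φ (x + z) = φ x) (x : ℚ) (z : ℤ) :
    eulerDepleteTable W v φ (x + z) = eulerDepleteTable W v φ x := by
  simp only [eulerDepleteTable]
  refine Finset.sum_congr rfl fun i _ ↦ ?_
  have h : (Rat.HeightOneSpectrum.natGenerator v : ℚ) ^ i * (x + z) =
      (Rat.HeightOneSpectrum.natGenerator v : ℚ) ^ i * x + ((Rat.HeightOneSpectrum.natGenerator v ^ i * z : ℤ) : ℚ) := by
    push_cast; ring
  rw [h, hφ]

/-- The depleted table of a `1`-periodic table is `1`-periodic. [cite: EmertonPollackWeston2006, §3 (3.4)–(3.5)] -/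
theorem eulerDepleteTableList_add_intCast' (l : List (HeightOneSpectrum (𝓞 ℚ))) {φ : ℚ → ℚ}
    (hφ : ∀ (x : ℚ) (z : ℤ), φ (x + z) = φ x) :
    ∀ (x : ℚ) (z : ℤ), eulerDepleteTableList W l φ (x + z) = eulerDepleteTableList W l φ x := by
  induction l with
  | nil => exact hφ
  | cons v l ih =>
    intro x z
    show eulerDepleteTable W v (eulerDepleteTableList W l φ) (x + z) =
      eulerDepleteTable W v (eulerDepleteTableList W l φ) x
    exact eulerDepleteTable_add_intCast W v ih x z

end Tables

/-! ## §2. Layer sums over `ℚ₂` and the one-place depletion step -/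

section Layer

variable (W : WeierstrassCurve ℚ)

/-- **Linearity of the layer sum in the table**: the layer sum of the one-place depleted table
`x ↦ Σ_i c_i ℓ^{-i} φ(ℓ^i x)` is `Σ_i C(c_i ℓ^{-i}) · ϑ_n(φ(ℓ^i ·))`. [cite: EmertonPollackWeston2006, §3 (3.4)–(3.5)] -/
theorem layerSum_eulerDepleteTable (v : HeightOneSpectrum (𝓞 ℚ)) (φ : ℚ → ℚ) (n : ℕ) :
    (∑ s : ZMod (2 ^ n), C ((eulerDepleteTable W v φ
        ((((cyclotomicGenerator 2 : ZMod (2 ^ (n + 2))) ^ s.val).val : ℚ) / (2 : ℚ) ^ (n + 2)) : ℚ) : ℚ_[2]) *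
        (X + 1 : ℚ_[2][X]) ^ s.val) =
      ∑ i ∈ Finset.range ((W.localPolynomialAt v).natDegree + 1),
        C (((eulerDepletionWeight W v i : ℚ) : ℚ_[2])) *
          ∑ s : ZMod (2 ^ n), C ((φ ((Rat.HeightOneSpectrum.natGenerator v : ℚ) ^ i *
            ((((cyclotomicGenerator 2 : ZMod (2 ^ (n + 2))) ^ s.val).val : ℚ) / (2 : ℚ) ^ (n + 2))) : ℚ) : ℚ_[2]) *
            (X + 1 : ℚ_[2][X]) ^ s.val := by
  simp only [eulerDepleteTable, Rat.cast_sum, Rat.cast_mul, map_sum, map_mul, Finset.sum_mul, Finset.mul_sum]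
  rw [Finset.sum_comm]
  refine Finset.sum_congr rfl fun i _ ↦ Finset.sum_congr rfl fun s _ ↦ ?_
  ring

/-- **The one-place depletion step at the layers.** For an even, `1`-periodic table `φ : ℚ → ℚ` and an odd place
`v = (ℓ)`: `(P_v ∘ (ℓ⁻¹(1+X)^{e_v})) · ϑ_n(φ) ≡ ϑ_n(P_v(ℓ⁻¹[ℓ])φ) (mod (1+X)^{2ⁿ} − 1)` in `ℚ₂[X]`,
`e_v = (−f_ℓ) mod 2ⁿ`: each monomial `(1+X)^{i e_v} = σ_{ℓ^i}⁻¹` acts as the dilation `[ℓ^i]`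
(`ThetaLayerLambdaCongruenceAtTwo.layerSum_dilate_congr`, with `ℓ^i ≡ ω^i 5^{i f_ℓ}`). [cite: GreenbergVatsal2000, §1 p. 9 (display (8))] -/
theorem comp_mul_layerSum_dvd_sub_layerSum_eulerDepleteTable (v : HeightOneSpectrum (𝓞 ℚ))
    (hv : ¬ 2 ∣ Rat.HeightOneSpectrum.natGenerator v) (φ : ℚ → ℚ) (hneg : ∀ x, φ (-x) = φ x)
    (hper : ∀ (x : ℚ) (z : ℤ), φ (x + z) = φ x) (n : ℕ) :
    ((X + 1) ^ 2 ^ n - 1 : ℚ_[2][X]) ∣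
      ((W.localPolynomialAt v).map (Int.castRingHom ℚ_[2])).comp
          (C ((Rat.HeightOneSpectrum.natGenerator v : ℚ_[2])⁻¹) * (X + 1) ^
            (PadicInt.toZModPow n (-(frobeniusExponent 2 (Rat.HeightOneSpectrum.natGenerator v : ℤ_[2])))).val) *
        (∑ s : ZMod (2 ^ n), C ((φ ((((cyclotomicGenerator 2 : ZMod (2 ^ (n + 2))) ^ s.val).val : ℚ) /
          (2 : ℚ) ^ (n + 2)) : ℚ) : ℚ_[2]) * (X + 1 : ℚ_[2][X]) ^ s.val) -
      ∑ s : ZMod (2 ^ n), C ((eulerDepleteTable W v φ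
        ((((cyclotomicGenerator 2 : ZMod (2 ^ (n + 2))) ^ s.val).val : ℚ) / (2 : ℚ) ^ (n + 2)) : ℚ) : ℚ_[2]) *
        (X + 1 : ℚ_[2][X]) ^ s.val := by
  set ℓ : ℕ := Rat.HeightOneSpectrum.natGenerator v with hℓ
  set e : ℕ := (PadicInt.toZModPow n (-(frobeniusExponent 2 (ℓ : ℤ_[2])))).val with he
  set F : ℕ := (PadicInt.toZModPow n (frobeniusExponent 2 (ℓ : ℤ_[2]))).val with hF
  set P : ℚ_[2][X] := (W.localPolynomialAt v).map (Int.castRingHom ℚ_[2]) with hP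
  -- the cast table `ψ = ((↑) ∘ φ) : ℚ → ℚ₂` is even and `1`-periodic
  set ψ : ℚ → ℚ_[2] := fun x ↦ ((φ x : ℚ) : ℚ_[2]) with hψ
  have hψneg : ∀ x, ψ (-x) = ψ x := fun x ↦ by simp only [hψ, hneg]
  have hψper : ∀ (x : ℚ) (z : ℤ), ψ (x + z) = ψ x := fun x z ↦ by simp only [hψ, hper]
  -- Teichmüller data `ℓ ≡ ω 5^F (mod 2^{n+2})`, `2ⁿ ∣ F + e`
  obtain ⟨ω, hω, hℓω⟩ := exists_sign_mul_cyclotomicGenerator_pow_eq hv n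
  rw [← hF] at hℓω
  have hFe : 2 ^ n ∣ F + e := by
    haveI : NeZero (2 ^ n) := ⟨pow_ne_zero _ two_ne_zero⟩
    rw [hF, he, map_neg]
    exact dvd_val_add_val_neg _
  -- expand the Euler factor
  have hdeg : P.natDegree ≤ (W.localPolynomialAt v).natDegree := Polynomial.natDegree_map_le
  rw [comp_eq_sum_range_of_natDegree_le hdeg, layerSum_eulerDepleteTable, Finset.sum_mul, ← Finset.sum_sub_distrib]
  refine Finset.dvd_sum fun i _ ↦ ?_
  -- the weights agree: `coeff_i(P) · ℓ^{-i} = ↑(eulerDepletionWeight W v i)`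
  have hw : C (P.coeff i) * (C ((ℓ : ℚ_[2])⁻¹) * (X + 1 : ℚ_[2][X]) ^ e) ^ i =
      C (((eulerDepletionWeight W v i : ℚ) : ℚ_[2])) * (X + 1) ^ (i * e) := by
    rw [mul_pow, ← map_pow, ← mul_assoc, ← map_mul, ← pow_mul, mul_comm i e]
    congr 2
    simp only [eulerDepletionWeight, hP, Polynomial.coeff_map, eq_intCast, hℓ]
    push_cast
    ring
  rw [hw, mul_assoc, ← mul_sub]
  refine dvd_mul_of_dvd_right ?_ _
  -- dilation by `m = ℓ^i ≡ ω^i 5^{iF}`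
  have hm : ((ℓ ^ i : ℕ) : ZMod (2 ^ (n + 2))) = ω ^ i * (cyclotomicGenerator 2 : ZMod (2 ^ (n + 2))) ^ (i * F) := by
    rw [Nat.cast_pow, hℓω, mul_pow, ← pow_mul, mul_comm F i]
  have hsign : ω ^ i = 1 ∨ ω ^ i = -1 := pow_eq_one_or_eq_neg_one hω i
  have hFG : 2 ^ n ∣ i * F + i * e := by rw [← mul_add]; exact hFe.mul_left i
  have h := layerSum_dilate_congr ψ hψneg hψper hsign hm hFG
  have hcast : ∀ s : ZMod (2 ^ n), ψ (((ℓ ^ i : ℕ) : ℚ) *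
      ((((cyclotomicGenerator 2 : ZMod (2 ^ (n + 2))) ^ s.val).val : ℚ) / (2 : ℚ) ^ (n + 2))) =
      ((φ ((ℓ : ℚ) ^ i * ((((cyclotomicGenerator 2 : ZMod (2 ^ (n + 2))) ^ s.val).val : ℚ) /
        (2 : ℚ) ^ (n + 2))) : ℚ) : ℚ_[2]) := fun s ↦ by
    simp only [hψ, Nat.cast_pow]
  simp only [hcast] at h
  rwa [← dvd_neg, neg_sub] at h

/-- **THE DEPLETION IDENTITY at the layers, list form.** For an even, `1`-periodic table `φ : ℚ → ℚ`, a list `l` of odd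
places and every `n`: in `ℚ₂[X]`,
`ϑ_n(φ) · ∏_{v ∈ l} P_v ∘ (ℓ_v⁻¹(1+X)^{e_v}) ≡ ϑ_n(eulerDepleteTableList W l φ) (mod (1+X)^{2ⁿ} − 1)` — the layer-`n`
Mazur–Tate element of the table depleted by `∏_{v∈l} P_v(ℓ_v⁻¹[ℓ_v])` is the Mazur–Tate element of the table times the
oriented Euler-factor product `∏ P_v(ℓ_v⁻¹ σ_{ℓ_v}⁻¹)` (Greenberg–Vatsal §1 (8): `θ_n(f_{Σ₀}) = θ_n(f)·∏ P_ℓ(ℓ⁻¹σ_ℓ⁻¹)`).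
[cite: GreenbergVatsal2000, §1 p. 9 (display (8))] [cite: EmertonPollackWeston2006, §3 (3.4)–(3.5)] -/
theorem layerSum_mul_prod_dvd_sub_layerSum_eulerDepleteTableList (l : List (HeightOneSpectrum (𝓞 ℚ)))
    (hl : ∀ v ∈ l, ¬ 2 ∣ Rat.HeightOneSpectrum.natGenerator v) (φ : ℚ → ℚ) (hneg : ∀ x, φ (-x) = φ x)
    (hper : ∀ (x : ℚ) (z : ℤ), φ (x + z) = φ x) (n : ℕ) :
    ((X + 1) ^ 2 ^ n - 1 : ℚ_[2][X]) ∣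
      (∑ s : ZMod (2 ^ n), C ((φ ((((cyclotomicGenerator 2 : ZMod (2 ^ (n + 2))) ^ s.val).val : ℚ) /
          (2 : ℚ) ^ (n + 2)) : ℚ) : ℚ_[2]) * (X + 1 : ℚ_[2][X]) ^ s.val) *
        (l.map fun v ↦ ((W.localPolynomialAt v).map (Int.castRingHom ℚ_[2])).comp
          (C ((Rat.HeightOneSpectrum.natGenerator v : ℚ_[2])⁻¹) * (X + 1) ^
            (PadicInt.toZModPow n (-(frobeniusExponent 2 (Rat.HeightOneSpectrum.natGenerator v : ℤ_[2])))).val)).prod -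
      ∑ s : ZMod (2 ^ n), C ((eulerDepleteTableList W l φ
        ((((cyclotomicGenerator 2 : ZMod (2 ^ (n + 2))) ^ s.val).val : ℚ) / (2 : ℚ) ^ (n + 2)) : ℚ) : ℚ_[2]) *
        (X + 1 : ℚ_[2][X]) ^ s.val := by
  induction l with
  | nil => simp [eulerDepleteTableList]
  | cons v l ih =>
    have hv : ¬ 2 ∣ Rat.HeightOneSpectrum.natGenerator v := hl v List.mem_cons_self
    have ih' := ih (fun w hw ↦ hl w (List.mem_cons_of_mem _ hw))
    rw [List.map_cons, List.prod_cons]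
    -- `ϑ(φ)·(F_v · Π_l) − ϑ(φ^{v::l}) = F_v · (ϑ(φ)·Π_l − ϑ(φ^l)) + (F_v · ϑ(φ^l) − ϑ(P_v[ℓ] φ^l))`
    have hstep := comp_mul_layerSum_dvd_sub_layerSum_eulerDepleteTable W v hv (eulerDepleteTableList W l φ)
      (eulerDepleteTableList_neg W l hneg) (eulerDepleteTableList_add_intCast' W l hper) n
    have e : ∀ (A Fv Pl B Cv : ℚ_[2][X]), A * (Fv * Pl) - Cv = Fv * (A * Pl - B) + (Fv * B - Cv) := fun _ _ _ _ _ ↦ by ring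
    rw [show eulerDepleteTableList W (v :: l) φ = eulerDepleteTable W v (eulerDepleteTableList W l φ) from rfl, e]
    exact dvd_add (dvd_mul_of_dvd_right ih' _) hstep

end Layer

end Summit.BirchSwinnertonDyer.BirchSwinnertonDyer.Theorems.MazurTateCongruenceAtTwoR

end
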